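import Mathlib
import Summits.NavierStokesRegularity.NavierStokesRegularity.Theorems.LerayQuarterDissipationFiniteDissipationLiouvilleSmallDissipationGapSharperStretching
import HarnessLib

/-!
# The dissipation threshold of the finite-dissipation stratum, file 1: the stretching bound with the
  HÖLDER DEFECT kept (route `LerayQuarterDissipation`, crux `FiniteDissipationLiouville`
  stmt-NavierStokesRegularity-22144; lead prover g14, helper — the `K`-direction analogue of the
  THRESHOLD-ONE chain `…ThresholdBudget/…/ThresholdOne`)

HONEST FRAMING. Label-free analysis helper about a HYPOTHETICAL object (a Type-I ancient mild field
in the KNSS gauge) under the additional hypothesis `∫‖DU(s)‖² ≤ K_U` on a similarity slice. Nothing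
here bears on Navier–Stokes regularity or blow-up; no summit is proved.

CONTENTS. `two_mul_integral_sqCutoff_stretching_add_hoelderDefect_le`: the weighted Ladyzhenskaya
pricing of the stretching term of `…SmallDissipationGapSharperStretching`, with the Hölder step
`‖g‖₄² ≤ X := (‖g‖₂‖g‖₆³)^{1/2}` (`g = φ_R Ω`) NOT thrown away: the defect
`H_R(s) = 2√K_U (X − ‖g‖₄²) ≥ 0` is carried on the left with the fixed coefficient `2√K_U`. At the
threshold `θ⁴ = 64/27` of the sharper small-dissipation rung the budget has no damping left and
`H_R` is its slack (file 2 `…ThresholdKBudget`); since equality in Hölder forces `|g|` to be two-valued,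
a singular member with vanishing defect cannot exist (files 3–5). [folklore; Ladyzhenskaya's inequality]
-/

noncomputable section

set_option linter.dupNamespace false

namespace Summit.NavierStokesRegularity.NavierStokesRegularity.Theorems.FiniteDissipationLiouville.ThresholdK

open MeasureTheory Set Filter Topology Metric InnerProductSpace Function Real
open scoped RealInnerProductSpace Laplacian ContDiff
open Literature.Analysis Literature.Analysis.FluidPDE
open Summit.NavierStokesRegularity.NavierStokesRegularity.Theorems
open Summit.NavierStokesRegularity.NavierStokesRegularity.Theorems.GaussianGap
open Summit.NavierStokesRegularity.NavierStokesRegularity.Theorems.SimilarityEnstrophy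
open Summit.NavierStokesRegularity.NavierStokesRegularity.Theorems.SmallDissipationGap

variable {C : ℝ} {V : ℝ → (EuclideanSpace ℝ (Fin 3)) → (EuclideanSpace ℝ (Fin 3))}

/-! ### The stretching term with free weights -/

/-- **The stretching term against the squared cutoff with free weights, KEEPING THE HÖLDER DEFECT.**
With `g = φ_R Ω`, `θ = √K_U(√K_S)³`, `X = (‖g‖₂‖g‖₆³)^{1/2} ≥ ‖g‖₄²` (Hölder) and the defect
`H = 2√K_U (X − ‖g‖₄²) ≥ 0`: `2∫φ_R²⟪DU Ω, Ω⟫ + H ≤ 2√K_U X ≤ 2θab³ ≤ (θm¹²/2) Z_R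
+ (3θ/(2m⁴))(1+δ)∫φ_R²‖∇Ω‖²_F + (3θ/(2m⁴))(1+δ⁻¹)(c₁/R)²∫_{B̄_{2R}}‖Ω‖²` (Cauchy–Schwarz, `‖DU‖₂ ≤ √K_U`,
Hölder `‖g‖₄⁴ ≤ ‖g‖₂‖g‖₆³`, Sobolev `‖g‖₆ ≤ K_S‖∇g‖₂`, the weighted product rule and the weighted Young
inequality of `…SmallDissipationGapSharperStretching`). The point: the defect `H` enters with the FIXED
coefficient `2√K_U`, so at the threshold `θ⁴ = 64/27` (where the budget has no damping left) it is the
slack of the budget. [folklore; Ladyzhenskaya's inequality] -/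
theorem two_mul_integral_sqCutoff_stretching_add_hoelderDefect_le (hV : IsTypeIAncientMild C V) {c₁ : ℝ}
    (hc₁ : ∀ R : ℝ, 0 < R → ∀ y : (EuclideanSpace ℝ (Fin 3)),
      ‖fderiv ℝ (fun z : (EuclideanSpace ℝ (Fin 3)) => smoothTransition (2 - ‖z‖ ^ 2 / R ^ 2)) y‖ ≤ c₁ / R)
    {R : ℝ} (hR : 0 < R) (s : ℝ) {KU : ℝ}
    (hint : Integrable (fun y => ‖fderiv ℝ (lerayOrbit V s) y‖ ^ 2))
    (hKU : ∫ y, ‖fderiv ℝ (lerayOrbit V s) y‖ ^ 2 ≤ KU) {δ m : ℝ} (hδ : 0 < δ) (hm : 0 < m) :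
    2 * (∫ y, smoothTransition (2 - ‖y‖ ^ 2 / R ^ 2) ^ 2 *
        ⟪fderiv ℝ (lerayOrbit V s) y (lerayVorticity V s y), lerayVorticity V s y⟫) +
      2 * Real.sqrt KU *
        (Real.sqrt (Real.sqrt (∫ y, ‖smoothTransition (2 - ‖y‖ ^ 2 / R ^ 2) • lerayVorticity V s y‖ ^ 2) *
            Real.sqrt (∫ y, ‖smoothTransition (2 - ‖y‖ ^ 2 / R ^ 2) • lerayVorticity V s y‖ ^ 6)) -
          Real.sqrt (∫ y, ‖smoothTransition (2 - ‖y‖ ^ 2 / R ^ 2) • lerayVorticity V s y‖ ^ 4)) ≤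
      (Real.sqrt KU * Real.sqrt (SNormLESNormFDerivOfEqConst (EuclideanSpace ℝ (Fin 3)) (volume : Measure (EuclideanSpace ℝ (Fin 3))) 2 : ℝ) ^ 3 * m ^ 12 / 2) *
          (∫ y, smoothTransition (2 - ‖y‖ ^ 2 / R ^ 2) ^ 2 * ‖lerayVorticity V s y‖ ^ 2) +
        (3 * (Real.sqrt KU * Real.sqrt (SNormLESNormFDerivOfEqConst (EuclideanSpace ℝ (Fin 3)) (volume : Measure (EuclideanSpace ℝ (Fin 3))) 2 : ℝ) ^ 3) / (2 * m ^ 4)) * (1 + δ) *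
          (∫ y, smoothTransition (2 - ‖y‖ ^ 2 / R ^ 2) ^ 2 *
            frobeniusNormSq (fderiv ℝ (lerayVorticity V s) y)) +
        (3 * (Real.sqrt KU * Real.sqrt (SNormLESNormFDerivOfEqConst (EuclideanSpace ℝ (Fin 3)) (volume : Measure (EuclideanSpace ℝ (Fin 3))) 2 : ℝ) ^ 3) / (2 * m ^ 4)) * (1 + δ⁻¹) *
          (c₁ / R) ^ 2 * ∫ y in closedBall (0 : (EuclideanSpace ℝ (Fin 3))) (2 * R), ‖lerayVorticity V s y‖ ^ 2 := by
  set KS : ℝ := (SNormLESNormFDerivOfEqConst (EuclideanSpace ℝ (Fin 3)) (volume : Measure (EuclideanSpace ℝ (Fin 3))) 2 : ℝ) with hKSdef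
  have hKS0 : 0 ≤ KS := NNReal.coe_nonneg _
  set φ : (EuclideanSpace ℝ (Fin 3)) → ℝ := fun z => smoothTransition (2 - ‖z‖ ^ 2 / R ^ 2) with hφdef
  set Ω := lerayVorticity V s with hΩdef
  set U := lerayOrbit V s with hUdef
  have hφ1 : ContDiff ℝ 1 φ := contDiff_smoothTransition_cutoff (n := 1) R
  have hφ0 : ∀ y, 0 ≤ φ y := fun y => smoothTransition_cutoff_nonneg R y
  have hφz : ∀ y ∉ closedBall (0 : (EuclideanSpace ℝ (Fin 3))) (2 * R), φ y = 0 := fun y hy =>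
    smoothTransition_cutoff_eq_zero_of_notMem hR hy
  have hφ2c : HasCompactSupport fun y : (EuclideanSpace ℝ (Fin 3)) => φ y ^ 2 := hasCompactSupport_sqCutoff hR
  have hΩ1 : ContDiff ℝ 1 Ω := signedBudget_contDiff_lerayVorticity_slice hV s (n := 1)
  have hU1 : ContDiff ℝ 1 U := mustSqueeze_contDiff_lerayOrbit_slice hV s (n := 1)
  have hcΩ : Continuous Ω := hΩ1.continuous
  have hcDΩ : Continuous (fderiv ℝ Ω) := hΩ1.continuous_fderiv one_ne_zero
  have hcDU : Continuous (fderiv ℝ U) := hU1.continuous_fderiv one_ne_zero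
  have hcφ : Continuous φ := hφ1.continuous
  have hcDφ : Continuous (fderiv ℝ φ) := hφ1.continuous_fderiv one_ne_zero
  have hcF : Continuous fun y => frobeniusNormSq (fderiv ℝ Ω y) :=
    continuous_frobeniusNormSq_fderiv_lerayVorticity hV s
  have add_sq : ∀ p q : ℝ, (p + q) ^ 2 ≤ (1 + δ) * p ^ 2 + (1 + δ⁻¹) * q ^ 2 := fun p q => by
    have h : (1 + δ) * p ^ 2 + (1 + δ⁻¹) * q ^ 2 - (p + q) ^ 2 = (δ * p - q) ^ 2 / δ := by
      field_simp
      ring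
    have h0 : 0 ≤ (δ * p - q) ^ 2 / δ := div_nonneg (sq_nonneg _) hδ.le
    linarith
  -- the test field `g = φ Ω`
  have hg1 : ContDiff ℝ 1 fun y => φ y • Ω y := hφ1.smul hΩ1
  have hcg : Continuous fun y => φ y • Ω y := hg1.continuous
  have hcDg : Continuous (fderiv ℝ fun y => φ y • Ω y) := hg1.continuous_fderiv one_ne_zero
  have hg0 : ∀ y ∉ closedBall (0 : (EuclideanSpace ℝ (Fin 3))) (2 * R), φ y • Ω y = 0 := fun y hy => by
    rw [hφz y hy, zero_smul]
  have hgts : tsupport (fun y => φ y • Ω y) ⊆ closedBall (0 : (EuclideanSpace ℝ (Fin 3))) (2 * R) :=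
    closure_minimal (fun y hy => by by_contra h; exact hy (hg0 y h)) isClosed_closedBall
  have hDg0 : ∀ y ∉ closedBall (0 : (EuclideanSpace ℝ (Fin 3))) (2 * R), fderiv ℝ (fun y => φ y • Ω y) y = 0 := fun y hy =>
    fderiv_of_notMem_tsupport ℝ fun h => hy (hgts h)
  have hcs : ∀ {f : (EuclideanSpace ℝ (Fin 3)) → ℝ}, (∀ y ∉ closedBall (0 : (EuclideanSpace ℝ (Fin 3))) (2 * R), f y = 0) → HasCompactSupport f :=
    fun hf => HasCompactSupport.intro (isCompact_closedBall (0 : (EuclideanSpace ℝ (Fin 3))) (2 * R)) hf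
  have hs2 : HasCompactSupport fun y => ‖φ y • Ω y‖ ^ 2 :=
    hcs fun y hy => by show ‖φ y • Ω y‖ ^ 2 = 0; rw [hg0 y hy]; simp
  have hs6 : HasCompactSupport fun y => ‖φ y • Ω y‖ ^ 6 :=
    hcs fun y hy => by show ‖φ y • Ω y‖ ^ 6 = 0; rw [hg0 y hy]; simp
  have hsB : HasCompactSupport fun y => ‖fderiv ℝ (fun y => φ y • Ω y) y‖ ^ 2 :=
    hcs fun y hy => by show ‖fderiv ℝ (fun y => φ y • Ω y) y‖ ^ 2 = 0; rw [hDg0 y hy]; simp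
  have hi2 : Integrable fun y => ‖φ y • Ω y‖ ^ 2 := (hcg.norm.pow 2).integrable_of_hasCompactSupport hs2
  have hi6 : Integrable fun y => ‖φ y • Ω y‖ ^ 6 := (hcg.norm.pow 6).integrable_of_hasCompactSupport hs6
  have hiB : Integrable fun y => ‖fderiv ℝ (fun y => φ y • Ω y) y‖ ^ 2 :=
    (hcDg.norm.pow 2).integrable_of_hasCompactSupport hsB
  -- (1) Sobolev `∫‖g‖⁶ ≤ (K_S √∫‖Dg‖²)⁶`
  have h6 := integral_norm_pow_six_le_of_integrable (volume : Measure (EuclideanSpace ℝ (Fin 3)))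
    finrank_euclideanSpace_fin hg1 hi2 hi6 hiB
  rw [← hKSdef] at h6
  set A : ℝ := ∫ y, ‖φ y • Ω y‖ ^ 2 with hAdef
  set B : ℝ := ∫ y, ‖fderiv ℝ (fun y => φ y • Ω y) y‖ ^ 2 with hBdef
  set I4 : ℝ := ∫ y, ‖φ y • Ω y‖ ^ 4 with hI4def
  set I6 : ℝ := ∫ y, ‖φ y • Ω y‖ ^ 6 with hI6def
  set Z : ℝ := ∫ y, φ y ^ 2 * ‖Ω y‖ ^ 2 with hZdef
  set D : ℝ := ∫ y, φ y ^ 2 * frobeniusNormSq (fderiv ℝ Ω y) with hDdef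
  set I : ℝ := ∫ y in closedBall (0 : (EuclideanSpace ℝ (Fin 3))) (2 * R), ‖Ω y‖ ^ 2 with hIdef
  set J : ℝ := ∫ y, ‖fderiv ℝ U y‖ ^ 2 with hJdef
  have hA0 : 0 ≤ A := integral_nonneg fun y => by positivity
  have hB0 : 0 ≤ B := integral_nonneg fun y => by positivity
  have hI0 : 0 ≤ I := integral_nonneg fun y => by positivity
  have hD0 : 0 ≤ D := integral_nonneg fun y => mul_nonneg (sq_nonneg _) (frobeniusNormSq_nonneg _)
  have hJ0 : 0 ≤ J := integral_nonneg fun y => by positivity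
  have hKU0 : 0 ≤ KU := hJ0.trans hKU
  have hI40 : 0 ≤ I4 := integral_nonneg fun y => by positivity
  have hI60 : 0 ≤ I6 := integral_nonneg fun y => by positivity
  -- `A = Z` (`‖φ Ω‖² = φ² ‖Ω‖²`)
  have hAZ : A = Z := integral_congr_ae (Eventually.of_forall fun y => by
    show ‖φ y • Ω y‖ ^ 2 = φ y ^ 2 * ‖Ω y‖ ^ 2
    rw [norm_smul, Real.norm_of_nonneg (hφ0 y), mul_pow])
  -- (2) fourth roots: `√I4 ≤ k³ a b³`
  set k := Real.sqrt KS with hk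
  set a := Real.sqrt (Real.sqrt A) with ha
  set b := Real.sqrt (Real.sqrt B) with hb
  have hk0 : 0 ≤ k := Real.sqrt_nonneg _
  have ha0 : 0 ≤ a := Real.sqrt_nonneg _
  have hb0 : 0 ≤ b := Real.sqrt_nonneg _
  have hkK : k ^ 2 = KS := Real.sq_sqrt hKS0
  have hsA : a ^ 2 = Real.sqrt A := Real.sq_sqrt (Real.sqrt_nonneg A)
  have hsB : b ^ 2 = Real.sqrt B := Real.sq_sqrt (Real.sqrt_nonneg B)
  have hAa : A = a ^ 4 := by rw [show a ^ 4 = (a ^ 2) ^ 2 by ring, hsA, Real.sq_sqrt hA0]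
  have hBb : B = b ^ 4 := by rw [show b ^ 4 = (b ^ 2) ^ 2 by ring, hsB, Real.sq_sqrt hB0]
  -- (2a) Hölder `I4 ≤ √A √I6` (`∫‖g‖·‖g‖³ ≤ ‖‖g‖‖₂ ‖‖g‖³‖₂`) and the mean `X = (√A √I6)^{1/2} ≥ √I4`
  have hmemg1 : MemLp (fun y => ‖φ y • Ω y‖) (ENNReal.ofReal 2) volume := by
    rw [ENNReal.ofReal_ofNat]
    exact hcg.norm.memLp_of_hasCompactSupport
      (hcs fun y hy => by show ‖φ y • Ω y‖ = 0; rw [hg0 y hy]; simp)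
  have hmemg3 : MemLp (fun y => ‖φ y • Ω y‖ ^ 3) (ENNReal.ofReal 2) volume := by
    rw [ENNReal.ofReal_ofNat]
    exact (hcg.norm.pow 3).memLp_of_hasCompactSupport
      (hcs fun y hy => by show ‖φ y • Ω y‖ ^ 3 = 0; rw [hg0 y hy]; simp)
  have hH : I4 ≤ Real.sqrt A * Real.sqrt I6 := by
    have h := integral_mul_norm_le_Lp_mul_Lq Real.HolderConjugate.two_two hmemg1 hmemg3
    have e0 : ∫ y, ‖‖φ y • Ω y‖‖ * ‖‖φ y • Ω y‖ ^ 3‖ = I4 :=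
      integral_congr_ae (Eventually.of_forall fun y => by
        show ‖‖φ y • Ω y‖‖ * ‖‖φ y • Ω y‖ ^ 3‖ = ‖φ y • Ω y‖ ^ 4
        rw [norm_norm, norm_pow, norm_norm]; ring)
    have e1 : ∫ y, ‖‖φ y • Ω y‖‖ ^ (2 : ℝ) = A := integral_congr_ae (Eventually.of_forall fun y => by
      show ‖‖φ y • Ω y‖‖ ^ (2 : ℝ) = ‖φ y • Ω y‖ ^ 2
      rw [norm_norm, Real.rpow_two])
    have e2 : ∫ y, ‖‖φ y • Ω y‖ ^ 3‖ ^ (2 : ℝ) = I6 := integral_congr_ae (Eventually.of_forall fun y => by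
      show ‖‖φ y • Ω y‖ ^ 3‖ ^ (2 : ℝ) = ‖φ y • Ω y‖ ^ 6
      rw [norm_pow, norm_norm, Real.rpow_two]; ring)
    rw [e0, e1, e2, ← Real.sqrt_eq_rpow, ← Real.sqrt_eq_rpow] at h
    exact h
  set X : ℝ := Real.sqrt (Real.sqrt A * Real.sqrt I6) with hXdef
  have hX0 : 0 ≤ X := Real.sqrt_nonneg _
  have hI4X : Real.sqrt I4 ≤ X := Real.sqrt_le_sqrt hH
  -- (2b) Sobolev in fourth roots: `X ≤ k³ a b³`
  have hXs : X ≤ k ^ 3 * a * b ^ 3 := by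
    have hsI6 : Real.sqrt I6 ≤ (k ^ 2 * b ^ 2) ^ 3 := by
      have h : I6 ≤ ((k ^ 2 * b ^ 2) ^ 3) ^ 2 :=
        h6.trans_eq (by rw [← hkK, ← hsB]; ring)
      have := Real.sqrt_le_sqrt h
      rwa [Real.sqrt_sq (by positivity)] at this
    have hX2 : Real.sqrt A * Real.sqrt I6 ≤ (k ^ 3 * a * b ^ 3) ^ 2 := by
      rw [← hsA]
      calc a ^ 2 * Real.sqrt I6 ≤ a ^ 2 * (k ^ 2 * b ^ 2) ^ 3 :=
            mul_le_mul_of_nonneg_left hsI6 (sq_nonneg _)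
        _ = (k ^ 3 * a * b ^ 3) ^ 2 := by ring
    have := Real.sqrt_le_sqrt hX2
    rwa [Real.sqrt_sq (by positivity)] at this
  -- (3) Cauchy–Schwarz: `∫ ‖DU‖ ‖g‖² ≤ √J √I4`
  have hmem1 : MemLp (fun y => ‖fderiv ℝ U y‖) (ENNReal.ofReal 2) volume := by
    rw [ENNReal.ofReal_ofNat]
    refine (memLp_two_iff_integrable_sq_norm hcDU.norm.aestronglyMeasurable).2 ?_
    exact hint.congr (Eventually.of_forall fun y => by simp only [norm_norm])
  have hmem2 : MemLp (fun y => ‖φ y • Ω y‖ ^ 2) (ENNReal.ofReal 2) volume := by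
    rw [ENNReal.ofReal_ofNat]
    exact (hcg.norm.pow 2).memLp_of_hasCompactSupport hs2
  have hCS : ∫ y, ‖fderiv ℝ U y‖ * ‖φ y • Ω y‖ ^ 2 ≤ Real.sqrt J * Real.sqrt I4 := by
    have h := integral_mul_norm_le_Lp_mul_Lq Real.HolderConjugate.two_two hmem1 hmem2
    have e0 : ∫ y, ‖‖fderiv ℝ U y‖‖ * ‖‖φ y • Ω y‖ ^ 2‖ = ∫ y, ‖fderiv ℝ U y‖ * ‖φ y • Ω y‖ ^ 2 :=
      integral_congr_ae (Eventually.of_forall fun y => by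
        show ‖‖fderiv ℝ U y‖‖ * ‖‖φ y • Ω y‖ ^ 2‖ = ‖fderiv ℝ U y‖ * ‖φ y • Ω y‖ ^ 2
        rw [norm_norm, norm_pow, norm_norm])
    have e1 : ∫ y, ‖‖fderiv ℝ U y‖‖ ^ (2 : ℝ) = J := integral_congr_ae (Eventually.of_forall fun y => by
      show ‖‖fderiv ℝ U y‖‖ ^ (2 : ℝ) = ‖fderiv ℝ U y‖ ^ 2
      rw [norm_norm, Real.rpow_two])
    have e2 : ∫ y, ‖‖φ y • Ω y‖ ^ 2‖ ^ (2 : ℝ) = I4 := integral_congr_ae (Eventually.of_forall fun y => by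
      show ‖‖φ y • Ω y‖ ^ 2‖ ^ (2 : ℝ) = ‖φ y • Ω y‖ ^ 4
      rw [norm_pow, norm_norm, Real.rpow_two]; ring)
    rw [e0, e1, e2, ← Real.sqrt_eq_rpow, ← Real.sqrt_eq_rpow] at h
    exact h
  -- (4) the stretching integrand against `‖DU‖ ‖g‖²`
  have hpt : ∀ y, φ y ^ 2 * ⟪fderiv ℝ U y (Ω y), Ω y⟫ ≤ ‖fderiv ℝ U y‖ * ‖φ y • Ω y‖ ^ 2 := by
    intro y
    have e : φ y ^ 2 * ⟪fderiv ℝ U y (Ω y), Ω y⟫ = ⟪fderiv ℝ U y (φ y • Ω y), φ y • Ω y⟫ := by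
      rw [map_smul, real_inner_smul_left, real_inner_smul_right]; ring
    rw [e]
    calc ⟪fderiv ℝ U y (φ y • Ω y), φ y • Ω y⟫ ≤ ‖fderiv ℝ U y (φ y • Ω y)‖ * ‖φ y • Ω y‖ :=
          real_inner_le_norm _ _
      _ ≤ ‖fderiv ℝ U y‖ * ‖φ y • Ω y‖ * ‖φ y • Ω y‖ :=
          mul_le_mul_of_nonneg_right (ContinuousLinearMap.le_opNorm _ _) (norm_nonneg _)
      _ = ‖fderiv ℝ U y‖ * ‖φ y • Ω y‖ ^ 2 := by ring
  have iS : Integrable fun y => φ y ^ 2 * ⟪fderiv ℝ U y (Ω y), Ω y⟫ :=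
    ((hcφ.pow 2).mul ((hcDU.clm_apply hcΩ).inner hcΩ)).integrable_of_hasCompactSupport hφ2c.mul_right
  have iP : Integrable fun y => ‖fderiv ℝ U y‖ * ‖φ y • Ω y‖ ^ 2 :=
    (hcDU.norm.mul (hcg.norm.pow 2)).integrable_of_hasCompactSupport
      (hcs fun y hy => by show ‖fderiv ℝ U y‖ * ‖φ y • Ω y‖ ^ 2 = 0; rw [hg0 y hy]; simp)
  have hS : (∫ y, φ y ^ 2 * ⟪fderiv ℝ U y (Ω y), Ω y⟫) ≤ Real.sqrt J * Real.sqrt I4 :=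
    (integral_mono iS iP hpt).trans hCS
  -- (5) `B ≤ 2 D + 2 (c₁/R)² I`
  have hDg : ∀ y, ‖fderiv ℝ (fun y => φ y • Ω y) y‖ ^ 2 ≤ (1 + δ) * (φ y ^ 2 * frobeniusNormSq (fderiv ℝ Ω y)) +
      (1 + δ⁻¹) * (‖fderiv ℝ φ y‖ ^ 2 * ‖Ω y‖ ^ 2) := by
    intro y
    have hdφ : DifferentiableAt ℝ φ y := hφ1.differentiable one_ne_zero y
    have hdΩ : DifferentiableAt ℝ Ω y := hΩ1.differentiable one_ne_zero y
    have e : fderiv ℝ (fun y => φ y • Ω y) y = φ y • fderiv ℝ Ω y + (fderiv ℝ φ y).smulRight (Ω y) :=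
      (hdφ.hasFDerivAt.smul hdΩ.hasFDerivAt).fderiv
    have hn : ‖fderiv ℝ (fun y => φ y • Ω y) y‖ ≤ φ y * ‖fderiv ℝ Ω y‖ + ‖fderiv ℝ φ y‖ * ‖Ω y‖ := by
      rw [e]
      refine (norm_add_le _ _).trans (add_le_add ?_ ?_)
      · rw [norm_smul, Real.norm_of_nonneg (hφ0 y)]
      · exact (ContinuousLinearMap.norm_smulRight_apply _ _).le
    have hop : ‖fderiv ℝ Ω y‖ ^ 2 ≤ frobeniusNormSq (fderiv ℝ Ω y) := sq_opNorm_le_frobeniusNormSq _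
    have hop' : φ y ^ 2 * ‖fderiv ℝ Ω y‖ ^ 2 ≤ φ y ^ 2 * frobeniusNormSq (fderiv ℝ Ω y) :=
      mul_le_mul_of_nonneg_left hop (sq_nonneg _)
    have hδ1 : 0 ≤ 1 + δ := by linarith
    calc ‖fderiv ℝ (fun y => φ y • Ω y) y‖ ^ 2
        ≤ (φ y * ‖fderiv ℝ Ω y‖ + ‖fderiv ℝ φ y‖ * ‖Ω y‖) ^ 2 :=
          pow_le_pow_left₀ (norm_nonneg _) hn 2
      _ ≤ (1 + δ) * (φ y * ‖fderiv ℝ Ω y‖) ^ 2 + (1 + δ⁻¹) * (‖fderiv ℝ φ y‖ * ‖Ω y‖) ^ 2 := add_sq _ _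
      _ = (1 + δ) * (φ y ^ 2 * ‖fderiv ℝ Ω y‖ ^ 2) + (1 + δ⁻¹) * (‖fderiv ℝ φ y‖ ^ 2 * ‖Ω y‖ ^ 2) := by ring
      _ ≤ (1 + δ) * (φ y ^ 2 * frobeniusNormSq (fderiv ℝ Ω y)) + (1 + δ⁻¹) * (‖fderiv ℝ φ y‖ ^ 2 * ‖Ω y‖ ^ 2) := by
          have := mul_le_mul_of_nonneg_left hop' hδ1
          linarith
  have iD : Integrable fun y => φ y ^ 2 * frobeniusNormSq (fderiv ℝ Ω y) :=
    ((hcφ.pow 2).mul hcF).integrable_of_hasCompactSupport hφ2c.mul_right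
  have hDφ0 : ∀ y ∉ closedBall (0 : (EuclideanSpace ℝ (Fin 3))) (2 * R), ‖fderiv ℝ φ y‖ ^ 2 = 0 := fun y hy => by
    rw [hφdef, signedBudget_fderiv_cutoff_eq_zero hR hy, norm_zero]; ring
  have iC : Integrable fun y => ‖fderiv ℝ φ y‖ ^ 2 * ‖Ω y‖ ^ 2 :=
    ((hcDφ.norm.pow 2).mul (hcΩ.norm.pow 2)).integrable_of_hasCompactSupport
      (hcs fun y hy => by show ‖fderiv ℝ φ y‖ ^ 2 * ‖Ω y‖ ^ 2 = 0; rw [hDφ0 y hy, zero_mul])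
  have hcollar : (∫ y, ‖fderiv ℝ φ y‖ ^ 2 * ‖Ω y‖ ^ 2) ≤ (c₁ / R) ^ 2 * I := by
    refine (le_abs_self _).trans (abs_integral_le_of_weight_sq hcΩ (w := fun y => ‖fderiv ℝ φ y‖ ^ 2)
      (hcDφ.norm.pow 2) hDφ0 (fun y _ => ?_) (fun y => ?_))
    · exact pow_le_pow_left₀ (norm_nonneg _) (hc₁ R hR y) 2
    · rw [abs_of_nonneg (by positivity)]
  have hδi : 0 ≤ 1 + δ⁻¹ := by positivity
  have hB : B ≤ (1 + δ) * D + (1 + δ⁻¹) * ((c₁ / R) ^ 2 * I) := by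
    calc B ≤ ∫ y, ((1 + δ) * (φ y ^ 2 * frobeniusNormSq (fderiv ℝ Ω y)) +
          (1 + δ⁻¹) * (‖fderiv ℝ φ y‖ ^ 2 * ‖Ω y‖ ^ 2)) :=
          integral_mono hiB ((iD.const_mul (1 + δ)).add (iC.const_mul (1 + δ⁻¹))) hDg
      _ = (1 + δ) * D + (1 + δ⁻¹) * ∫ y, ‖fderiv ℝ φ y‖ ^ 2 * ‖Ω y‖ ^ 2 := by
          rw [integral_add (iD.const_mul (1 + δ)) (iC.const_mul (1 + δ⁻¹)), integral_const_mul,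
            integral_const_mul]
      _ ≤ (1 + δ) * D + (1 + δ⁻¹) * ((c₁ / R) ^ 2 * I) := by
          have := mul_le_mul_of_nonneg_left hcollar hδi
          linarith
  -- (6) assemble: `2(√K_U X) ≤ RHS` by the weighted Young scalar lemma, and `2S + H ≤ 2√K_U X`
  have hKX := two_mul_le_of_weightedYoung (S := Real.sqrt KU * X) (J := KU) (I₄ := X ^ 2) hk0 ha0 hb0 hm
    (by rw [Real.sqrt_sq hX0]) (by rw [Real.sqrt_sq hX0]; exact hXs) le_rfl hAa hBb hB
  rw [← hAZ]
  have hSK : (∫ y, φ y ^ 2 * ⟪fderiv ℝ U y (Ω y), Ω y⟫) ≤ Real.sqrt KU * Real.sqrt I4 :=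
    hS.trans (mul_le_mul_of_nonneg_right (Real.sqrt_le_sqrt hKU) (Real.sqrt_nonneg _))
  have e : 2 * Real.sqrt KU * (X - Real.sqrt I4) =
      2 * (Real.sqrt KU * X) - 2 * (Real.sqrt KU * Real.sqrt I4) := by ring
  rw [e]
  linarith

end Summit.NavierStokesRegularity.NavierStokesRegularity.Theorems.FiniteDissipationLiouville.ThresholdK

end
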